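import Literature.AlgebraicGeometry.Resolution.BlowupRegularPairCharts
import Literature.AlgebraicGeometry.Resolution.BlowupsIntegral
import Literature.AlgebraicGeometry.Resolution.BlowupsProperProofs
import Literature.AlgebraicGeometry.Resolution.OriginLocalRing
import Mathlib.AlgebraicGeometry.Morphisms.Smooth
import Mathlib.Algebra.MvPolynomial.Division
import HarnessLib

/-!
# The plane blown up at the origin is smooth over EVERY field: the two affine-plane charts of
# any blowing up of `𝔸²_K` at the origin

Topic: `Literature/AlgebraicGeometry/Resolution`. Theorem-only file (sorry-free, no named fact, no definition of a new
notion: the `def`s below are abbreviations for the fixed data of the affine plane — coordinate ring, structure map, origin,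
its reduced ideal sheaf, the coordinate functions, the chart opens and the coordinate change of the charts).

Let `K` be ANY field (perfect or not), `P = Spec K[x₀,x₁] = 𝔸²_K`, `ξ ∈ P` the origin and `𝓘 = 𝓘_{ξ}` the reduced
ideal sheaf of the closed point `ξ` (`vanishingIdeal`). For EVERY blowing up `π : W → P` of `P` along `𝓘` (universal
property `IsBlowup`, `Blowups.lean`) we prove:

* `ideal_𝓘_top` — `𝓘(P) = (x₀, x₁)` as an ideal of `Γ(P, ⊤) ≅ K[x₀,x₁]`;
* `chart π i` (`i : Fin 2`) — the principal chart `W[⊤, xᵢ]` of the tree (`BlowupPrincipalCharts.lean`); it is affine,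
  and `chart π 0 ⊔ chart π 1 = ⊤` (Stacks 0804; tree `IsBlowup.blowupChart_sup_blowupChart_pair`);
* `exists_chartEquiv` — **each chart is an affine plane**: a ring isomorphism `Γ(W, W[⊤,xᵢ]) ≃+* K[s,t]` under which
  `π^*` is `xᵢ ↦ s`, `xⱼ ↦ s·t` (`j ≠ i`) (tree `IsBlowup.exists_ringEquiv_blowupChart_pair` for the regular pair
  `(xᵢ, xⱼ)` of the UFD `K[x₀,x₁]`, composed with the explicit `K[x₀,x₁][X]/(xᵢX − xⱼ) ≅ K[s,t]`);
* `smooth_comp` — **`W → Spec K` is SMOOTH**, for every field `K` (Mathlib: `Smooth` has the affine-local ring-hom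
  property `RingHom.Smooth`; on each chart the composite `K → Γ(W, W[⊤,xᵢ]) ≅ K[s,t]` is the structure map of a polynomial
  algebra); `isIntegral`, `irreducibleSpace`, `isProper`, `quasiCompact_comp` — `W` is integral and `W → Spec K` is
  quasi-compact.

WHY (cell res-hironaka, LADDER-RESOLUTION rung L, slot W4.6): the restricted-regime rungs of the typed Th. 16.6 procedure
(`CampaignW46.*`) are typed for EVERY field `K` of characteristic `p`, but every EXISTENCE theorem about permissible blow-up
sequences in the tree carries `[PerfectField K]`, used only to turn «regular» into «smooth over `K`» (centre and blown-up
ambient). Over an imperfect `K` regular ≠ smooth at points with inseparable residue field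
(`Literature/Barriers/ResolutionOfSingularities/SmoothVsRegularImperfectBase.lean`), but at the `K`-RATIONAL origin and on the
blown-up PLANE no perfectness is needed: this file. Consumers: the Hironaka2017-side packaging as a row-001
`AmbientDatum` (`Literature/AlgebraicGeometry/Hironaka2017/Lib/RationalPointCentre.lean`) and the W4.6 length-1 witness over
every field.

## References

* The Stacks Project, Tags 0804 (affine blow-up algebra and its charts), 0BIQ (blow-up of a regular sequence). [cite: StacksProject, Tag 0804]
* R. Hartshorne, *Algebraic Geometry* (1977), I Ex. 4.?/II Thm. 8.24 context: the blow-up of `𝔸²` at a point is covered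
  by two affine planes. [Hartshorne1977]
* A. Grothendieck, EGA IV₄ (1967), Prop. 17.5.8 (iii) (`𝔸ⁿ_S → S` is smooth). [Grothendieck1967]
-/

noncomputable section

set_option backward.isDefEq.respectTransparency false

open CategoryTheory AlgebraicGeometry TopologicalSpace Opposite MvPolynomial

namespace Literature.AlgebraicGeometry.Resolution

namespace PlanePointBlowup

open Scheme.IdealSheafData

universe u

variable (K : Type u) [Field K]

/-! ## The plane, its structure map, the origin -/

/-- The coordinate ring `K[x₀, x₁]`. [folklore] -/
abbrev A : Type u := MvPolynomial (Fin 2) K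

/-- The affine plane `P = Spec K[x₀, x₁]`. [folklore] -/
abbrev P : Scheme.{u} := Spec (.of (A K))

/-- The structure morphism `P → Spec K`. [folklore] -/
def f : P K ⟶ Spec (.of K) := Spec.map (CommRingCat.ofHom (algebraMap K (A K)))

/-- `K[x₀, x₁]` is a smooth `K`-algebra. [folklore] -/
instance smooth_A : Algebra.Smooth K (A K) := {}

/-- `𝔸²_K → Spec K` is smooth (every field, indeed every ring). [cite: Grothendieck1967, Prop. 17.5.8 (iii) (PDF p. 69)] -/
theorem smooth_f : Smooth (f K) := by
  rw [f, HasRingHomProperty.Spec_iff (P := @Smooth), CommRingCat.hom_ofHom, RingHom.smooth_algebraMap]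
  infer_instance

/-- The origin `ξ = (x₀, x₁)` (the tree's `originIdeal K 2`). [folklore] -/
def ξ : P K := ⟨originIdeal K 2, inferInstance⟩

/-- The origin is a closed point. [cite: StacksProject, Tag 01HR] -/
theorem isClosed_ξ : IsClosed ({ξ K} : Set (P K)) :=
  (PrimeSpectrum.isClosed_singleton_iff_isMaximal _).mpr (originIdeal.isMaximal (F := K) (n := 2))

/-- The origin as a closed subset. [folklore] -/
def C₀ : Closeds (P K) := ⟨{ξ K}, isClosed_ξ K⟩

/-- The reduced ideal sheaf `𝓘 = 𝓘_{ξ}` of the origin. [folklore] -/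
def 𝓘 : (P K).IdealSheafData := vanishingIdeal (C₀ K)

/-- The affine open `⊤ ⊆ P`. [folklore] -/
def Wtop : (P K).affineOpens := ⟨⊤, isAffineOpen_top _⟩

/-- `Γ(Spec K, ⊤) ≅ K`. [folklore] -/
def ε : Γ(Spec (.of K), ⊤) ≃+* K := (Scheme.ΓSpecIso (.of K)).commRingCatIsoToRingEquiv

/-- `ε⁻¹ c = ΓSpecIso⁻¹ c`. [cite: StacksProject, Tag 01HR] -/
theorem ε_symm_apply (c : K) : (ε K).symm c = (Scheme.ΓSpecIso (.of K)).inv.hom c := rfl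

/-- `Γ(P, ⊤) ≅ K[x₀, x₁]`. [folklore] -/
def γ : Γ(P K, Wtop K) ≃+* A K := (Scheme.ΓSpecIso (.of (A K))).commRingCatIsoToRingEquiv

/-- `γ⁻¹ a = ΓSpecIso⁻¹ a`. [cite: StacksProject, Tag 01HR] -/
theorem γ_symm_apply (a : A K) : (γ K).symm a = (Scheme.ΓSpecIso (.of (A K))).inv.hom a := rfl

/-- `Γ(P, ⊤)` is a domain. [cite: StacksProject, Tag 01HR] -/
instance isDomain_Γ : IsDomain Γ(P K, Wtop K) := MulEquiv.isDomain (A K) (γ K).toMulEquiv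

/-- The coordinate functions `xᵢ ∈ Γ(P, ⊤)`. [folklore] -/
def coord (i : Fin 2) : Γ(P K, Wtop K) := (γ K).symm (X i)

/-- `γ xᵢ = Xᵢ`. [cite: StacksProject, Tag 01HR] -/
@[simp] theorem γ_coord (i : Fin 2) : γ K (coord K i) = X i := (γ K).apply_symm_apply _

/-- The point of `Spec Γ(P, ⊤)` corresponding to the origin: `γ⁻¹(x₀, x₁)`. [folklore] -/
def ξt : PrimeSpectrum Γ(P K, Wtop K) :=
  ⟨(originIdeal K 2).comap (γ K : Γ(P K, Wtop K) →+* A K), Ideal.comap_isPrime _ _⟩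

/-- `(x₀, x₁) = span {X 0, X 1}`. [cite: StacksProject, Tag 01HR] -/
theorem originIdeal_two_eq_span_pair : originIdeal K 2 = Ideal.span {(X 0 : A K), X 1} := by
  rw [originIdeal_eq_span]
  congr 1
  ext a
  simp only [Set.mem_range, Set.mem_insert_iff, Set.mem_singleton_iff]
  constructor
  · rintro ⟨i, rfl⟩
    fin_cases i
    · exact Or.inl rfl
    · exact Or.inr rfl
  · rintro (rfl | rfl)
    · exact ⟨0, rfl⟩
    · exact ⟨1, rfl⟩

/-- `γ⁻¹(x₀, x₁) = (coord 0, coord 1)`. [cite: StacksProject, Tag 01HR] -/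
theorem ξt_asIdeal : (ξt K).asIdeal = Ideal.span {coord K 0, coord K 1} := by
  change (originIdeal K 2).comap (γ K : Γ(P K, Wtop K) →+* A K) = _
  apply le_antisymm
  · intro s hs
    rw [Ideal.mem_comap, originIdeal_two_eq_span_pair, Ideal.mem_span_pair] at hs
    obtain ⟨a, b, hab⟩ := hs
    rw [Ideal.mem_span_pair]
    refine ⟨(γ K).symm a, (γ K).symm b, (γ K).injective ?_⟩
    rw [map_add, map_mul, map_mul, γ_coord, γ_coord, (γ K).apply_symm_apply, (γ K).apply_symm_apply, hab]
    rfl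
  · rw [Ideal.span_le]
    rintro s (rfl | rfl)
    · show (γ K : Γ(P K, Wtop K) →+* A K) (coord K 0) ∈ originIdeal K 2
      rw [RingEquiv.coe_toRingHom, γ_coord, mem_originIdeal_iff, constantCoeff_X]
    · show (γ K : Γ(P K, Wtop K) →+* A K) (coord K 1) ∈ originIdeal K 2
      rw [RingEquiv.coe_toRingHom, γ_coord, mem_originIdeal_iff, constantCoeff_X]

/-- `Spec Γ(P, ⊤) → P` is `Spec` of `ΓSpecIso⁻¹`. [cite: StacksProject, Tag 01HR] -/
theorem fromSpec_Wtop : (Wtop K).2.fromSpec = Spec.map (Scheme.ΓSpecIso (.of (A K))).inv := by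
  change (isAffineOpen_top (P K)).fromSpec = _
  rw [IsAffineOpen.fromSpec_top, Scheme.isoSpec_Spec_inv]

/-- The only point of `Spec Γ(P, ⊤)` over `ξ` is `ξt`. [cite: StacksProject, Tag 01HR] -/
theorem fromSpec_Wtop_eq_ξ_iff (q : PrimeSpectrum Γ(P K, Wtop K)) : (Wtop K).2.fromSpec q = ξ K ↔ q = ξt K := by
  rw [fromSpec_Wtop]
  have hid₁ : ((Scheme.ΓSpecIso (.of (A K))).inv.hom).comp (γ K : Γ(P K, Wtop K) →+* A K) = RingHom.id _ :=
    RingHom.ext fun s => (γ K).symm_apply_apply s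
  have hid₂ : (γ K : Γ(P K, Wtop K) →+* A K).comp (Scheme.ΓSpecIso (.of (A K))).inv.hom = RingHom.id _ :=
    RingHom.ext fun a => (γ K).apply_symm_apply a
  constructor
  · intro hq
    have h1 : (q.asIdeal).comap (Scheme.ΓSpecIso (.of (A K))).inv.hom = originIdeal K 2 :=
      congrArg PrimeSpectrum.asIdeal hq
    apply PrimeSpectrum.ext
    change q.asIdeal = (originIdeal K 2).comap (γ K : Γ(P K, Wtop K) →+* A K)
    rw [← h1, Ideal.comap_comap, hid₁, Ideal.comap_id]
  · rintro rfl
    apply PrimeSpectrum.ext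
    change ((originIdeal K 2).comap (γ K : Γ(P K, Wtop K) →+* A K)).comap (Scheme.ΓSpecIso (.of (A K))).inv.hom =
      originIdeal K 2
    rw [Ideal.comap_comap, hid₂, Ideal.comap_id]

/-- **`𝓘_{ξ}(⊤) = (x₀, x₁)`.** [cite: StacksProject, Tag 01HR] -/
theorem ideal_𝓘_top : (𝓘 K).ideal (Wtop K) = Ideal.span {coord K 0, coord K 1} := by
  rw [𝓘, vanishingIdeal_ideal]
  have hpre : ((fun q => (Wtop K).2.fromSpec q) ⁻¹' ((C₀ K : Closeds (P K)) : Set (P K))) = {ξt K} := by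
    ext q
    rw [Set.mem_preimage, Set.mem_singleton_iff, ← fromSpec_Wtop_eq_ξ_iff]
    rfl
  have key := congrArg PrimeSpectrum.vanishingIdeal hpre
  rw [PrimeSpectrum.vanishingIdeal_singleton, ξt_asIdeal] at key
  exact key

/-- `𝓘_{ξ}(⊤) = (xᵢ, xⱼ)` for the two orderings of the coordinates. [cite: StacksProject, Tag 01HR] -/
theorem ideal_𝓘_top_pair {i j : Fin 2} (hij : i ≠ j) : (𝓘 K).ideal (Wtop K) = Ideal.span {coord K i, coord K j} := by
  rw [ideal_𝓘_top]
  fin_cases i <;> fin_cases j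
  · exact absurd rfl hij
  · rfl
  · exact Ideal.span_pair_comm
  · exact absurd rfl hij

/-- `xᵢ ∈ 𝓘_{ξ}(⊤)`. [cite: StacksProject, Tag 01HR] -/
theorem coord_mem (i : Fin 2) : coord K i ∈ (𝓘 K).ideal (Wtop K) := by
  rw [ideal_𝓘_top]
  fin_cases i
  · exact Ideal.subset_span (by simp)
  · exact Ideal.subset_span (by simp)

/-- `xᵢ ≠ 0` in `Γ(P, ⊤)`. [cite: StacksProject, Tag 01HR] -/
theorem coord_ne_zero (i : Fin 2) : coord K i ≠ 0 := by
  intro h0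
  have := congrArg (γ K) h0
  rw [γ_coord, map_zero] at this
  exact X_ne_zero i this

/-- `xᵢ` is a nonzerodivisor of `Γ(P, ⊤)`. [cite: StacksProject, Tag 0BIQ] -/
theorem coord_mem_nonZeroDivisors (i : Fin 2) : coord K i ∈ nonZeroDivisors Γ(P K, Wtop K) :=
  mem_nonZeroDivisors_of_ne_zero (coord_ne_zero K i)

/-- `(xᵢ, xⱼ)` is a regular pair: `xᵢ ∣ r·xⱼ ⇒ xᵢ ∣ r` (`i ≠ j`). [cite: StacksProject, Tag 0BIQ] -/
theorem coord_dvd_of_dvd_mul {i j : Fin 2} (hij : i ≠ j) (r : Γ(P K, Wtop K)) (h : coord K i ∣ r * coord K j) :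
    coord K i ∣ r := by
  have h1 : (X i : A K) ∣ γ K r * X j := by
    have := map_dvd (γ K : Γ(P K, Wtop K) →+* A K) h
    simpa using this
  have h2 : (X i : A K) ∣ γ K r := by
    rcases (MvPolynomial.X_dvd_mul_iff).mp h1 with h3 | h3
    · exact h3
    · exact absurd (MvPolynomial.X_dvd_X.mp h3) hij
  have h4 := map_dvd ((γ K).symm : A K →+* Γ(P K, Wtop K)) h2
  simpa [coord] using h4

/-- `𝓘_{ξ} ≠ 0`. [cite: StacksProject, Tag 01HR] -/
theorem 𝓘_ne_bot : 𝓘 K ≠ ⊥ := by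
  intro h
  have h1 : coord K 0 ∈ (𝓘 K).ideal (Wtop K) := coord_mem K 0
  rw [h, Scheme.IdealSheafData.ideal_bot] at h1
  exact coord_ne_zero K 0 h1

/-! ## Algebra: `Γ(P,⊤)[X]/(xᵢ X − xⱼ) ≅ K[s, t]` -/

/-- The chart coordinate ring `B = K[s, t]` (`s = X 0`, `t = X 1`). [folklore] -/
abbrev B : Type u := MvPolynomial (Fin 2) K

section Algebra

variable (i j : Fin 2)

/-- `π^*` in coordinates on the `xᵢ`-chart: `K[x₀,x₁] → K[s,t]`, `xᵢ ↦ s`, `xⱼ ↦ s·t` (`j ≠ i`). [folklore] -/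
def φ : A K →ₐ[K] B K := aeval fun k : Fin 2 => if k = i then X 0 else X 0 * X 1

/-- `φ xᵢ = s`. [cite: StacksProject, Tag 0BIQ] -/
@[simp] theorem φ_X_self : φ K i (X i : A K) = X 0 := by simp [φ]

variable {i j} in
/-- `φ xⱼ = s·t` (`j ≠ i`). [cite: StacksProject, Tag 0BIQ] -/
theorem φ_X_other (hij : i ≠ j) : φ K i (X j : A K) = X 0 * X 1 := by
  simp [φ, hij.symm]

/-- The relation ideal `(xᵢ X − xⱼ)` of `Γ(P,⊤)[X]`. [folklore] -/
abbrev rel : Ideal (Polynomial Γ(P K, Wtop K)) :=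
  Ideal.span {Polynomial.C (coord K i) * Polynomial.X - Polynomial.C (coord K j)}

/-- `Γ(P,⊤)[X] → B`, `s ↦ φ(γ s)`, `X ↦ t`. [folklore] -/
def θ₀ : Polynomial Γ(P K, Wtop K) →+* B K :=
  Polynomial.eval₂RingHom ((φ K i : A K →+* B K).comp (γ K : Γ(P K, Wtop K) →+* A K)) (X 1)

/-- `θ₀` on constants. [cite: StacksProject, Tag 0BIQ] -/
@[simp] theorem θ₀_C (s : Γ(P K, Wtop K)) : θ₀ K i (Polynomial.C s) = φ K i (γ K s) := by
  simp [θ₀]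

/-- `θ₀ X = t`. [cite: StacksProject, Tag 0BIQ] -/
@[simp] theorem θ₀_X : θ₀ K i Polynomial.X = X 1 := by
  simp [θ₀]

variable {i j} in
/-- `θ₀` kills the relation `xᵢ X − xⱼ`. [cite: StacksProject, Tag 0BIQ] -/
theorem θ₀_rel (hij : i ≠ j) : ∀ a ∈ rel K i j, θ₀ K i a = 0 := by
  intro a ha
  obtain ⟨c, rfl⟩ := Ideal.mem_span_singleton'.mp ha
  rw [map_mul, map_sub, map_mul, θ₀_C, θ₀_C, θ₀_X, γ_coord, γ_coord, φ_X_self, φ_X_other K hij, sub_self, mul_zero]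

variable {i j} in
/-- `Γ(P,⊤)[X]/(xᵢ X − xⱼ) → B`. [folklore] -/
def θ (hij : i ≠ j) : (Polynomial Γ(P K, Wtop K) ⧸ rel K i j) →+* B K :=
  Ideal.Quotient.lift _ (θ₀ K i) (θ₀_rel K hij)

variable {i j} in
/-- `θ` on classes. [cite: StacksProject, Tag 0BIQ] -/
@[simp] theorem θ_mk (hij : i ≠ j) (a : Polynomial Γ(P K, Wtop K)) :
    θ K hij (Ideal.Quotient.mk _ a) = θ₀ K i a := Ideal.Quotient.lift_mk _ _ _

/-- `B → Γ(P,⊤)[X]/(xᵢ X − xⱼ)`, `s ↦ x̄ᵢ`, `t ↦ X̄`. [folklore] -/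
def χ : B K →+* (Polynomial Γ(P K, Wtop K) ⧸ rel K i j) :=
  eval₂Hom ((Ideal.Quotient.mk _).comp (Polynomial.C.comp
      (((γ K).symm : A K →+* Γ(P K, Wtop K)).comp (algebraMap K (A K)))))
    fun k : Fin 2 => if k = 0 then Ideal.Quotient.mk _ (Polynomial.C (coord K i)) else Ideal.Quotient.mk _ Polynomial.X

/-- `χ s = x̄ᵢ`. [cite: StacksProject, Tag 0BIQ] -/
@[simp] theorem χ_X0 : χ K i j (X 0) = Ideal.Quotient.mk _ (Polynomial.C (coord K i)) := by
  simp [χ]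

/-- `χ t = X̄`. [cite: StacksProject, Tag 0BIQ] -/
@[simp] theorem χ_X1 : χ K i j (X 1) = Ideal.Quotient.mk _ Polynomial.X := by
  simp [χ]

/-- `χ` on constants. [cite: StacksProject, Tag 0BIQ] -/
@[simp] theorem χ_C (c : K) : χ K i j (C c) = Ideal.Quotient.mk _ (Polynomial.C ((γ K).symm (C c))) := by
  simp [χ]

variable {i j} in
/-- `χ ∘ φ = (s ↦ s̄) ∘ γ⁻¹` on `K[x₀,x₁]`. [cite: StacksProject, Tag 0BIQ] -/
theorem χ_comp_φ (hij : i ≠ j) : (χ K i j).comp (φ K i : A K →+* B K) =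
    (Ideal.Quotient.mk _).comp (Polynomial.C.comp ((γ K).symm : A K →+* Γ(P K, Wtop K))) := by
  refine MvPolynomial.ringHom_ext (fun c => ?_) (fun k => ?_)
  · simp [φ]
  · by_cases hk : k = i
    · subst hk
      change χ K k j (φ K k (X k)) = Ideal.Quotient.mk _ (Polynomial.C ((γ K).symm (X k)))
      rw [φ_X_self, χ_X0]
      rfl
    · have hkj : k = j := by
        revert hij hk
        fin_cases i <;> fin_cases j <;> fin_cases k <;> decide
      subst hkj
      change χ K i k (φ K i (X k)) = Ideal.Quotient.mk _ (Polynomial.C ((γ K).symm (X k)))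
      rw [φ_X_other K hij, map_mul, χ_X0, χ_X1, ← map_mul, Ideal.Quotient.eq, Ideal.mem_span_singleton]
      exact ⟨1, by rw [mul_one]; rfl⟩

variable {i j} in
/-- `θ ∘ χ = id`. [cite: StacksProject, Tag 0BIQ] -/
theorem θ_comp_χ (hij : i ≠ j) : (θ K hij).comp (χ K i j) = RingHom.id (B K) := by
  refine MvPolynomial.ringHom_ext (fun c => ?_) (fun k => ?_)
  · rw [RingHom.comp_apply, χ_C, RingHom.id_apply, θ_mk, θ₀_C, (γ K).apply_symm_apply]
    exact (φ K i).commutes c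
  · fin_cases k
    · change θ K hij (χ K i j (X 0)) = X 0
      rw [χ_X0, θ_mk, θ₀_C, γ_coord, φ_X_self]
    · change θ K hij (χ K i j (X 1)) = X 1
      rw [χ_X1, θ_mk, θ₀_X]

variable {i j} in
/-- `χ ∘ θ = id`. [cite: StacksProject, Tag 0BIQ] -/
theorem χ_comp_θ (hij : i ≠ j) : (χ K i j).comp (θ K hij) = RingHom.id _ := by
  refine Ideal.Quotient.ringHom_ext (Polynomial.ringHom_ext (fun s => ?_) ?_)
  · change χ K i j (θ K hij (Ideal.Quotient.mk _ (Polynomial.C s))) = Ideal.Quotient.mk _ (Polynomial.C s)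
    rw [θ_mk, θ₀_C]
    have h := congrArg (fun F : A K →+* _ => F (γ K s)) (χ_comp_φ K hij)
    simp only [RingHom.comp_apply, AlgHom.coe_toRingHom, RingEquiv.coe_toRingHom, (γ K).symm_apply_apply] at h
    exact h
  · change χ K i j (θ K hij (Ideal.Quotient.mk _ Polynomial.X)) = Ideal.Quotient.mk _ Polynomial.X
    rw [θ_mk, θ₀_X, χ_X1]

variable {i j} in
/-- `Γ(P,⊤)[X]/(xᵢ X − xⱼ) ≅ K[s, t]`. [folklore] -/
def ψ (hij : i ≠ j) : (Polynomial Γ(P K, Wtop K) ⧸ rel K i j) ≃+* B K :=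
  RingEquiv.ofRingHom (θ K hij) (χ K i j) (θ_comp_χ K hij) (χ_comp_θ K hij)

variable {i j} in
/-- `ψ (s̄) = φ (γ s)` on constants. [cite: StacksProject, Tag 0BIQ] -/
theorem ψ_mk_C (hij : i ≠ j) (s : Γ(P K, Wtop K)) :
    ψ K hij (Ideal.Quotient.mk _ (Polynomial.C s)) = φ K i (γ K s) := by
  change θ K hij (Ideal.Quotient.mk _ (Polynomial.C s)) = _
  rw [θ_mk, θ₀_C]

variable {i j} in
/-- `ψ (X̄) = t`. [cite: StacksProject, Tag 0BIQ] -/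
theorem ψ_mk_X (hij : i ≠ j) : ψ K hij (Ideal.Quotient.mk _ Polynomial.X) = X 1 := by
  change θ K hij (Ideal.Quotient.mk _ Polynomial.X) = _
  rw [θ_mk, θ₀_X]

end Algebra

/-! ## The charts of a blowing up of the plane at the origin -/

section Blowup

variable {K}
variable {W : Scheme.{u}} (π : W ⟶ P K)

/-- **The chart `W[⊤, xᵢ]`** of a morphism `π : W → P` (the tree's principal chart of `π` for `(⊤, xᵢ)`).
[cite: StacksProject, Tag 0804] -/
def chart (i : Fin 2) : W.Opens := blowupChart π (𝓘 K) (Wtop K) (coord K i)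

/-- `W[⊤, xᵢ] ≤ π⁻¹(⊤)`. [cite: StacksProject, Tag 0804] -/
theorem chart_le (i : Fin 2) : chart π i ≤ π ⁻¹ᵁ ((Wtop K) : (P K).Opens) :=
  blowupChart_le_preimage π (𝓘 K) (Wtop K) (coord K i)

variable {π} (hπ : IsBlowup π (𝓘 K))
include hπ

/-- The charts of a blowing up are affine. [cite: StacksProject, Tag 0804] -/
theorem isAffineOpen_chart (i : Fin 2) : IsAffineOpen (chart π i) :=
  hπ.isAffineOpen_blowupChart (coord_mem K i)

/-- **The two charts cover the blow-up**: `W[⊤, x₀] ∪ W[⊤, x₁] = W`. [cite: StacksProject, Tag 0804] -/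
theorem chart_sup_chart : chart π 0 ⊔ chart π 1 = ⊤ := by
  have h := hπ.blowupChart_sup_blowupChart_pair (Wtop K) (ideal_𝓘_top K)
  exact h

/-- The same, as an indexed supremum over `Fin 2`. [cite: StacksProject, Tag 0804] -/
theorem iSup_chart : (⨆ i : Fin 2, ((⟨chart π i, isAffineOpen_chart hπ i⟩ : W.affineOpens) : W.Opens)) = ⊤ := by
  rw [← chart_sup_chart hπ]
  apply le_antisymm
  · refine iSup_le fun i => ?_
    fin_cases i
    · exact le_sup_left
    · exact le_sup_right
  · exact sup_le (le_iSup (fun i : Fin 2 => ((⟨chart π i, isAffineOpen_chart hπ i⟩ : W.affineOpens) : W.Opens)) 0)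
      (le_iSup (fun i : Fin 2 => ((⟨chart π i, isAffineOpen_chart hπ i⟩ : W.affineOpens) : W.Opens)) 1)

/-- **Each chart is an affine plane**: `Γ(W, W[⊤, xᵢ]) ≅ K[s, t]` with `π^* xᵢ ↦ s`, `π^* xⱼ ↦ s·t`.
[cite: StacksProject, Tag 0BIQ] -/
theorem exists_chartEquiv {i j : Fin 2} (hij : i ≠ j) :
    ∃ Φ : Γ(W, chart π i) ≃+* B K,
      ∀ s, Φ ((π.appLE (Wtop K) (chart π i) (chart_le π i)).hom s) = φ K i (γ K s) := by
  obtain ⟨e, he⟩ := hπ.exists_ringEquiv_blowupChart_pair (Wtop K) (ideal_𝓘_top_pair K hij)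
    (coord_mem_nonZeroDivisors K i) (coord_dvd_of_dvd_mul K hij)
  exact ⟨e.trans (ψ K hij), fun s => (congrArg (ψ K hij) (he s)).trans (ψ_mk_C K hij s)⟩

omit hπ in
/-- The structure map in global sections: `(f^*) (ε⁻¹ c) = γ⁻¹ (c)` (`ΓSpecIso` is natural). [cite: StacksProject, Tag 01HR] -/
theorem appTop_f_apply (c : K) : (f K).appTop.hom ((ε K).symm c) = (γ K).symm (algebraMap K (A K) c) := by
  have h := congrArg (fun F => CommRingCat.Hom.hom F c)
    (Scheme.ΓSpecIso_inv_naturality (CommRingCat.ofHom (algebraMap K (A K))))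
  simp only [CommRingCat.hom_comp, RingHom.comp_apply, CommRingCat.hom_ofHom] at h
  rw [ε_symm_apply, γ_symm_apply, f]
  exact h.symm

omit hπ in
/-- `(π ≫ f)^*` on the chart factors through `π^*` and `f^*`. [cite: StacksProject, Tag 01HR] -/
theorem appLE_comp_hom_apply (i : Fin 2) (c : K) :
    ((π ≫ f K).appLE ⊤ (chart π i) le_top).hom ((ε K).symm c) =
      (π.appLE (Wtop K) (chart π i) (chart_le π i)).hom ((γ K).symm (algebraMap K (A K) c)) := by
  have happ : (f K).appLE ⊤ (Wtop K) le_top ≫ π.appLE (Wtop K) (chart π i) (chart_le π i) =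
      (π ≫ f K).appLE ⊤ (chart π i) le_top := Scheme.Hom.appLE_comp_appLE _ _ _ _ _ _ _
  have hf : (f K).appLE ⊤ (Wtop K) le_top = (f K).appTop := by
    change (f K).appLE ⊤ (Wtop K) le_top = (f K).app ⊤
    rw [Scheme.Hom.app_eq_appLE]
    rfl
  rw [← happ, CommRingCat.hom_comp, RingHom.comp_apply, hf]
  exact congrArg _ (appTop_f_apply (K := K) c)

/-- The ring map `Γ(Spec K, ⊤) → Γ(W, W[⊤, xᵢ])` of `W[⊤,xᵢ] → Spec K` is, up to the isomorphisms
`Γ(Spec K, ⊤) ≅ K` and `Γ(W, W[⊤,xᵢ]) ≅ K[s,t]`, the structure map of the polynomial algebra. [cite: StacksProject, Tag 0804] -/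
theorem exists_appLE_comp_eq {i j : Fin 2} (hij : i ≠ j) :
    ∃ Φ : Γ(W, chart π i) ≃+* B K,
      ((Φ : Γ(W, chart π i) →+* B K).comp (((π ≫ f K).appLE ⊤ (chart π i) le_top).hom)).comp
          ((ε K).symm : K →+* Γ(Spec (.of K), ⊤)) = algebraMap K (B K) := by
  obtain ⟨Φ, hΦ⟩ := exists_chartEquiv hπ hij
  refine ⟨Φ, RingHom.ext fun c => ?_⟩
  simp only [RingHom.comp_apply, RingEquiv.coe_toRingHom]
  rw [appLE_comp_hom_apply, hΦ, (γ K).apply_symm_apply]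
  exact (φ K i).commutes c

/-- On each chart the ring map of `W[⊤,xᵢ] → Spec K` is SMOOTH (a polynomial algebra in two variables up to isomorphism).
[cite: Grothendieck1967, Prop. 17.5.8 (iii) (PDF p. 69)] -/
theorem smooth_appLE_chart (i : Fin 2) : ((π ≫ f K).appLE ⊤ (chart π i) le_top).hom.Smooth := by
  obtain ⟨j, hij⟩ : ∃ j : Fin 2, i ≠ j := by
    fin_cases i
    · exact ⟨1, by decide⟩
    · exact ⟨0, by decide⟩
  obtain ⟨Φ, hΦ⟩ := exists_appLE_comp_eq hπ hij
  have halg : (algebraMap K (B K)).Smooth := RingHom.smooth_algebraMap.mpr inferInstance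
  have h1 : ((π ≫ f K).appLE ⊤ (chart π i) le_top).hom =
      ((Φ.symm : B K →+* Γ(W, chart π i)).comp (algebraMap K (B K))).comp ((ε K) : Γ(Spec (.of K), ⊤) →+* K) := by
    ext c
    have h2 := congrArg (fun F : K →+* B K => F (ε K c)) hΦ
    simp only [RingHom.comp_apply, RingEquiv.coe_toRingHom, RingEquiv.symm_apply_apply] at h2
    simp only [RingHom.comp_apply, RingEquiv.coe_toRingHom]
    rw [← h2, RingEquiv.symm_apply_apply]
  rw [h1]
  exact RingHom.Smooth.comp (RingHom.Smooth.of_bijective (ε K).bijective)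
    (RingHom.Smooth.comp halg (RingHom.Smooth.of_bijective Φ.symm.bijective))

/-- **The plane blown up at the origin is SMOOTH over `K` — every field `K`.** [cite: Grothendieck1967, Prop. 17.5.8 (iii) (PDF p. 69)] -/
theorem smooth_comp : Smooth (π ≫ f K) :=
  HasRingHomProperty.of_iSup_eq_top (P := @Smooth) (fun i : Fin 2 => ⟨chart π i, isAffineOpen_chart hπ i⟩)
    (iSup_chart hπ) (smooth_appLE_chart hπ)

/-- The blow-up of the plane at the origin is integral. [cite: StacksProject, Tag 02ND] -/
theorem isIntegral : IsIntegral W := hπ.isIntegral (𝓘_ne_bot K)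

/-- The blow-up of the plane at the origin is irreducible. [cite: StacksProject, Tag 02ND] -/
theorem irreducibleSpace : IrreducibleSpace W := hπ.irreducibleSpace (𝓘_ne_bot K)

/-- The blowing up is proper. [cite: StacksProject, Tag 02NS] -/
theorem isProper : IsProper π := hπ.isProper

/-- `W → Spec K` is quasi-compact. [cite: StacksProject, Tag 02NS] -/
theorem quasiCompact_comp : QuasiCompact (π ≫ f K) := by
  haveI : IsProper π := hπ.isProper
  haveI : QuasiCompact (f K) := by rw [f]; infer_instance
  infer_instance

/-- `W → Spec K` is locally of finite type. [cite: StacksProject, Tag 02NS] -/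
theorem locallyOfFiniteType_comp : LocallyOfFiniteType (π ≫ f K) := by
  haveI := smooth_comp hπ
  infer_instance

end Blowup

end PlanePointBlowup

end Literature.AlgebraicGeometry.Resolution

end
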